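import Summits.QuantumFields.BalabanUV.T4Continuum.Support.VariationalAdditive

/-!
# T⁴ programme, spine node NE2 (U1a), lane P2 — THE TIER-⁺ ASSEMBLY OF THE VARIATIONAL ROUTE, KERNEL-CHECKED MODULO LEAF-SHAPED HYPOTHESES:
# existence of the constrained minimisers from coercivity (compactness), and the canonical-pair ADDITIVE bracket
# `|Δ_{k+1}(U′)(μ) − Δ_k(Ū′)(μ)| ≤ E·q(μ)` from the five leaves UB⁺ / P⁺ / FED⁺ / ONE⁺ / REG⁺ stated as inequalities on abstract data
# (`t4/skeletons/NE2-t4-ne2-p2.md` v0.5 §2.C/§3; cell `pub-balaban`, row NE2 co-owner #2, lineage t4-ne2-p2 gen 10)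

HONEST FRAMING (T4-DAG p. 1).  Rung (B)+1 only — NOT infinite volume, NOT a mass gap, NOT Clay.  NE2 is NOT IN PRINT and NOT proved here.  This
file is the route's COMPOSITION: abstract carriers (finite-dimensional normed spaces `V`, `W`, a `T1` space `Z` of unit data), abstract
nonnegative "actions" `Sc`, `Sf`, "averagings" `Qk`, `Q₁`, "sizes" `qV`, `qW`, `qZ` and a "regularity functional" `ρ`; the five leaves of the
skeleton enter as HYPOTHESES OF EXACTLY THEIR TYPED SHAPE (no `def … : Prop`, nothing printed, nothing of the audited series):
  UB⁺  `∀ μ, ∃ f, Qk f = μ ∧ Sc f ≤ Λ·qZ μ` (and the same one level up for the composite constraint),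
  P⁺   `∀ f, qW f ≤ C_P·(Sc f + qZ (Qk f))` (and for `Sf`, `Qk ∘ Q₁`)                 — `Support/VariationalCovariantPoincare` (p211276),
  FED⁺ `∀ f′, Sc (Q₁ f′) ≤ (√(Sf f′) + δ·√(qV f′))²`                                  — `Support/VariationalCovariantFederbush` (p210720),
  ONE⁺ `∀ f, T_{Q₁}Sf (f) ≤ Sc f + ε₁·ρ f + ε₂·qW f`                                  — open (explicit covariant interpolant),
  REG⁺ `∀ μ f, f minimises Sc on the fibre of μ → ρ f ≤ C_R·(Sc f + qZ μ)`             — open (Weitzenböck + Euler–Lagrange),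
and the conclusions are: the minimisers EXIST (`exists_isMinOn_fib`, from P⁺ by compactness — no KKT needed), and **`pair_bracket`**:
`Δ_k(μ) ≤ Δ_{k+1}(μ) + e·qZ μ`, `Δ_{k+1}(μ) ≤ Δ_k(μ) + e′·qZ μ` with `e = 2δ√(ΛC_P(Λ+1)) + δ²C_P(Λ+1)`, `e′ = (ε₁C_R + ε₂C_P)(Λ+1)` — i.e. the
fields `federbush`/`consistent` of `VariationalPairShape.PairDefects` DISCHARGED from the leaf shapes, through `VariationalAdditive.step_additive`.
For the scalar covariant sector (charged scalar) `δ = √d·(n·m)` (mismatch), `ε₁ ≍ n⁻²`, so `e + e′ ≍ α·L^{−k} + L^{−2k}`: the canonical-pair rate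
WITHOUT node NE3 and WITHOUT propagator localisation.  No `sorry`; axioms standard.  HONEST DEPENDENCY (cell, verbatim): continuum YM on T⁴ ⇐
BetaPertH ∧ nine spine estimates (0/9 proved); BetaPertH ⇐ (D1) ∧ (D4) ∧ CAP+tail; G-an2-4 gates asym, D1 and NE2/3/4.
-/

noncomputable section

namespace Summit.QuantumFields.BalabanUV.T4Continuum.VariationalCovariantAssembly

open Set
open Summit.QuantumFields.BalabanUV.T4Continuum.VariationalTransfer
open Summit.QuantumFields.BalabanUV.T4Continuum.VariationalAdditive

/-! ## §1 Existence of constrained minimisers from coercivity (leaf P⁺ ⟹ the `minimiser` fields), by compactness -/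

section Existence

variable {W Z : Type*} [NormedAddCommGroup W] [ProperSpace W] [TopologicalSpace Z] [T1Space Z]

/-- **A COERCIVE CONTINUOUS ACTION ATTAINS ITS INFIMUM ON EVERY NONEMPTY FIBRE** (finite-dimensional carriers): if `‖f‖² ≤ κ·q f` and
`q f ≤ C·(S f + qZ (Q f))` (the shape of leaf P⁺), then `S` has a minimiser on `{f : Q f = μ}`.  (Sublevel sets inside a fibre are closed and
bounded, hence compact.)  No Euler–Lagrange / KKT structure is needed for the variational bracket. [folklore] -/
theorem exists_isMinOn_fib {Q : W → Z} (hQ : Continuous Q) {S : W → ℝ} (hS : Continuous S) {q : W → ℝ} {qZ : Z → ℝ} {κ C : ℝ}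
    (hκ : 0 ≤ κ) (hC : 0 ≤ C) (hnorm : ∀ f, ‖f‖ ^ 2 ≤ κ * q f) (hcoer : ∀ f, q f ≤ C * (S f + qZ (Q f)))
    {μ : Z} {f₁ : W} (hf₁ : Q f₁ = μ) :
    ∃ f₀, Q f₀ = μ ∧ ∀ f, Q f = μ → S f₀ ≤ S f := by
  set K : Set W := Q ⁻¹' {μ} ∩ {f | S f ≤ S f₁} with hK
  have hmem : ∀ f, f ∈ K ↔ Q f = μ ∧ S f ≤ S f₁ := fun f => by simp [hK]
  have hKclosed : IsClosed K := (isClosed_singleton.preimage hQ).inter (isClosed_le hS continuous_const)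
  set r : ℝ := Real.sqrt (κ * (C * (S f₁ + qZ μ))) with hr
  have hKbdd : Bornology.IsBounded K := by
    refine (Metric.isBounded_iff_subset_closedBall 0).mpr ⟨r, fun f hf => ?_⟩
    obtain ⟨hQf, hSf⟩ := (hmem f).1 hf
    rw [Metric.mem_closedBall, dist_zero_right]
    have h1 : ‖f‖ ^ 2 ≤ κ * (C * (S f₁ + qZ μ)) := by
      calc ‖f‖ ^ 2 ≤ κ * q f := hnorm f
        _ ≤ κ * (C * (S f + qZ (Q f))) := mul_le_mul_of_nonneg_left (hcoer f) hκ
        _ ≤ κ * (C * (S f₁ + qZ μ)) := by rw [hQf]; gcongr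
    calc ‖f‖ = Real.sqrt (‖f‖ ^ 2) := (Real.sqrt_sq (norm_nonneg f)).symm
      _ ≤ r := Real.sqrt_le_sqrt h1
  have hKc : IsCompact K := Metric.isCompact_of_isClosed_isBounded hKclosed hKbdd
  have hne : K.Nonempty := ⟨f₁, (hmem f₁).2 ⟨hf₁, le_rfl⟩⟩
  obtain ⟨f₀, hf₀K, hmin⟩ := hKc.exists_isMinOn hne hS.continuousOn
  refine ⟨f₀, ((hmem f₀).1 hf₀K).1, fun f hf => ?_⟩
  by_cases h : S f ≤ S f₁
  · exact hmin ((hmem f).2 ⟨hf, h⟩)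
  · push Not at h
    exact (((hmem f₀).1 hf₀K).2).trans h.le

end Existence

/-! ## §2 The canonical-pair bracket from the leaf shapes -/

section Pair

variable {V W Z : Type*} [NormedAddCommGroup V] [ProperSpace V] [NormedAddCommGroup W] [ProperSpace W] [TopologicalSpace Z] [T1Space Z]

/-- bookkeeping for the FED⁺ defect: for `s ≤ Λ·z`, `v ≤ P·z`, `0 ≤ z`:
`2·√s·(δ·√v) + δ²·v ≤ (2δ·√(Λ·P) + δ²·P)·z`. [folklore] -/
theorem defect_bound {s v z Λ P δ : ℝ} (hδ : 0 ≤ δ) (hΛ : 0 ≤ Λ) (hP : 0 ≤ P) (hz : 0 ≤ z)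
    (hs : s ≤ Λ * z) (hv : v ≤ P * z) :
    2 * Real.sqrt s * (δ * Real.sqrt v) + δ ^ 2 * v ≤ (2 * δ * Real.sqrt (Λ * P) + δ ^ 2 * P) * z := by
  have h1 : Real.sqrt s ≤ Real.sqrt Λ * Real.sqrt z := by rw [← Real.sqrt_mul hΛ]; exact Real.sqrt_le_sqrt hs
  have h2 : Real.sqrt v ≤ Real.sqrt P * Real.sqrt z := by rw [← Real.sqrt_mul hP]; exact Real.sqrt_le_sqrt hv
  have hzz : Real.sqrt z * Real.sqrt z = z := Real.mul_self_sqrt hz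
  have hΛP : Real.sqrt Λ * Real.sqrt P = Real.sqrt (Λ * P) := (Real.sqrt_mul hΛ P).symm
  have h3 : Real.sqrt s * Real.sqrt v ≤ Real.sqrt (Λ * P) * z := by
    calc Real.sqrt s * Real.sqrt v ≤ (Real.sqrt Λ * Real.sqrt z) * (Real.sqrt P * Real.sqrt z) :=
          mul_le_mul h1 h2 (Real.sqrt_nonneg _) (by positivity)
      _ = (Real.sqrt Λ * Real.sqrt P) * (Real.sqrt z * Real.sqrt z) := by ring
      _ = Real.sqrt (Λ * P) * z := by rw [hzz, hΛP]
  nlinarith [mul_le_mul_of_nonneg_left h3 (by positivity : (0:ℝ) ≤ 2 * δ), mul_le_mul_of_nonneg_left hv (sq_nonneg δ)]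

/-- **THE CANONICAL-PAIR ADDITIVE BRACKET FROM THE LEAF SHAPES** (skeleton §3, kernel): coarse data `(Qk, Sc)` on `W`, fine data `(Q₁, Sf)`
on `V`, unit data in `Z`; sizes `qW`, `qV`, `qZ` with the norm dominations needed for compactness; leaves UB⁺ (both levels), P⁺ (both levels),
FED⁺, ONE⁺ (with a regularity functional `ρ`), REG⁺ as hypotheses ⟹ for every `μ`:
`Δ_k(μ) ≤ Δ_{k+1}(μ) + e·qZ μ` and `Δ_{k+1}(μ) ≤ Δ_k(μ) + e′·qZ μ`, `Δ_k := T_{Qk} Sc`, `Δ_{k+1} := T_{Qk∘Q₁} Sf`,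
`e = 2δ√(Λ·C_P(Λ+1)) + δ²·C_P(Λ+1)`, `e′ = (ε₁·C_R + ε₂·C_P)·(Λ+1)`.  Nothing of NE3; no propagator localisation. [folklore] -/
theorem pair_bracket
    {Qk : W → Z} {Q₁ : V → W} {Sc : W → ℝ} {Sf : V → ℝ} {qW : W → ℝ} {qV : V → ℝ} {qZ : Z → ℝ} {ρ : W → ℝ}
    (hQk : Continuous Qk) (hQ₁ : Continuous Q₁) (hSc : Continuous Sc) (hSf : Continuous Sf) (hsurj : Function.Surjective Q₁)
    (hSc0 : ∀ f, 0 ≤ Sc f) (hSf0 : ∀ f', 0 ≤ Sf f') (hqV0 : ∀ f', 0 ≤ qV f') (hqZ0 : ∀ μ, 0 ≤ qZ μ)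
    {κ Λ CP CR δ ε₁ ε₂ : ℝ} (hκ : 0 ≤ κ) (hΛ : 0 ≤ Λ) (hCP : 0 ≤ CP) (hCR : 0 ≤ CR) (hδ : 0 ≤ δ) (hε₁ : 0 ≤ ε₁) (hε₂ : 0 ≤ ε₂)
    (hnormW : ∀ f, ‖f‖ ^ 2 ≤ κ * qW f) (hnormV : ∀ f', ‖f'‖ ^ 2 ≤ κ * qV f')
    -- leaf UB⁺ at both levels
    (hUBc : ∀ μ, ∃ f, Qk f = μ ∧ Sc f ≤ Λ * qZ μ) (hUBf : ∀ μ, ∃ f', Qk (Q₁ f') = μ ∧ Sf f' ≤ Λ * qZ μ)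
    -- leaf P⁺ at both levels
    (hPc : ∀ f, qW f ≤ CP * (Sc f + qZ (Qk f))) (hPf : ∀ f', qV f' ≤ CP * (Sf f' + qZ (Qk (Q₁ f'))))
    -- leaf FED⁺ (additive covariant Federbush)
    (hFED : ∀ f', Sc (Q₁ f') ≤ (Real.sqrt (Sf f') + δ * Real.sqrt (qV f')) ^ 2)
    -- leaf ONE⁺ (one-step consistency, additive, with regularity functional ρ) and leaf REG⁺ (regularity of coarse minimisers)
    (hONE : ∀ f, blockSpin Q₁ Sf f ≤ Sc f + ε₁ * ρ f + ε₂ * qW f)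
    (hREG : ∀ μ f, Qk f = μ → (∀ g, Qk g = μ → Sc f ≤ Sc g) → ρ f ≤ CR * (Sc f + qZ μ))
    (μ : Z) :
    blockSpin Qk Sc μ ≤ blockSpin (Qk ∘ Q₁) Sf μ + (2 * δ * Real.sqrt (Λ * (CP * (Λ + 1))) + δ ^ 2 * (CP * (Λ + 1))) * qZ μ ∧
      blockSpin (Qk ∘ Q₁) Sf μ ≤ blockSpin Qk Sc μ + ((ε₁ * CR + ε₂ * CP) * (Λ + 1)) * qZ μ := by
  -- the coarse minimiser (P⁺ coercivity + UB⁺ nonemptiness)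
  obtain ⟨fU, hfU, hfUb⟩ := hUBc μ
  obtain ⟨f₀, hf₀, hmin⟩ := exists_isMinOn_fib (qZ := qZ) hQk hSc hκ hCP hnormW hPc hfU
  -- the fine minimiser for the composite constraint
  obtain ⟨gU, hgU, hgUb⟩ := hUBf μ
  have hPf' : ∀ f', qV f' ≤ CP * (Sf f' + qZ ((Qk ∘ Q₁) f')) := fun f' => by simpa using hPf f'
  obtain ⟨g₀, hg₀, hmin'⟩ := exists_isMinOn_fib (Q := Qk ∘ Q₁) (qZ := qZ) (hQk.comp hQ₁) hSf hκ hCP hnormV hPf'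
    (f₁ := gU) (by simpa using hgU)
  have hg₀' : Qk (Q₁ g₀) = μ := by simpa using hg₀
  have hminf : ∀ f', Qk (Q₁ f') = μ → Sf g₀ ≤ Sf f' := fun f' hf' => hmin' f' (by simpa using hf')
  -- sizes of the two minimisers
  have hSf_le : Sf g₀ ≤ Λ * qZ μ := (hminf gU hgU).trans hgUb
  have hSc_le : Sc f₀ ≤ Λ * qZ μ := (hmin fU hfU).trans hfUb
  have hqV_le : qV g₀ ≤ CP * (Λ + 1) * qZ μ := by
    calc qV g₀ ≤ CP * (Sf g₀ + qZ (Qk (Q₁ g₀))) := hPf g₀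
      _ ≤ CP * (Λ * qZ μ + qZ μ) := by rw [hg₀']; gcongr
      _ = CP * (Λ + 1) * qZ μ := by ring
  have hqW_le : qW f₀ ≤ CP * (Λ + 1) * qZ μ := by
    calc qW f₀ ≤ CP * (Sc f₀ + qZ (Qk f₀)) := hPc f₀
      _ ≤ CP * (Λ * qZ μ + qZ μ) := by rw [hf₀]; gcongr
      _ = CP * (Λ + 1) * qZ μ := by ring
  have hρ_le : ρ f₀ ≤ CR * (Λ + 1) * qZ μ := by
    calc ρ f₀ ≤ CR * (Sc f₀ + qZ μ) := hREG μ f₀ hf₀ hmin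
      _ ≤ CR * (Λ * qZ μ + qZ μ) := by gcongr
      _ = CR * (Λ + 1) * qZ μ := by ring
  -- FED⁺ at the fine minimiser: additive defect e·qZ μ
  have hF : Sc (Q₁ g₀) ≤ Sf g₀ + (2 * δ * Real.sqrt (Λ * (CP * (Λ + 1))) + δ ^ 2 * (CP * (Λ + 1))) * qZ μ := by
    have h := hFED g₀
    have hqV_le' : qV g₀ ≤ CP * (Λ + 1) * qZ μ := hqV_le
    have hdef := defect_bound (s := Sf g₀) (v := qV g₀) (z := qZ μ) (P := CP * (Λ + 1)) hδ hΛ (by positivity) (hqZ0 μ)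
      hSf_le hqV_le'
    rw [add_sq, Real.sq_sqrt (hSf0 g₀), mul_pow, Real.sq_sqrt (hqV0 g₀)] at h
    linarith
  -- ONE⁺ at the coarse minimiser: additive defect e′·qZ μ
  have hc : blockSpin Q₁ Sf f₀ ≤ Sc f₀ + ((ε₁ * CR + ε₂ * CP) * (Λ + 1)) * qZ μ := by
    have h := hONE f₀
    have : ε₁ * ρ f₀ + ε₂ * qW f₀ ≤ ((ε₁ * CR + ε₂ * CP) * (Λ + 1)) * qZ μ := by
      nlinarith [mul_le_mul_of_nonneg_left hρ_le hε₁, mul_le_mul_of_nonneg_left hqW_le hε₂]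
    linarith
  exact step_additive hsurj hSc0 hSf0 hf₀ hmin hg₀' hminf hF hc

end Pair

end Summit.QuantumFields.BalabanUV.T4Continuum.VariationalCovariantAssembly

end
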